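import Literature.NumberTheory.EllipticCurves.IwasawaCoinvariantsRankProofs
import Literature.NumberTheory.EllipticCurves.IwasawaOrderKernelRankProofs
import Literature.NumberTheory.EllipticCurves.ZpCorankStable
import Literature.NumberTheory.EllipticCurves.TwistedHeegnerTransportSign
import Literature.NumberTheory.EllipticCurves.TwistedHeegnerFamilyExistence
import Literature.NumberTheory.EllipticCurves.VariableChangePointsGalois
import Literature.NumberTheory.EllipticCurves.SelmerRestrictionCorank
import Literature.NumberTheory.EllipticCurves.H1CorestrictionIndexTwo
import Literature.NumberTheory.EllipticCurves.QuadraticTwistSelmerPInfty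
import Literature.NumberTheory.EllipticCurves.DiscreteH1Equiv
import Literature.NumberTheory.EllipticCurves.KatoRankBoundSelmerProofs
import Literature.NumberTheory.EllipticCurves.Greenberg1999.SelmerCorankLayerBoundAtTwoProofs
import Literature.NumberTheory.EllipticCurves.ZpExtensionLayersLocalSymbolProofs
import Literature.NumberTheory.EllipticCurves.ZpCorankQuasiIso
import Mathlib.NumberTheory.Real.Irrational
import HarnessLib

/-!
# `corank Sel_{p^∞}(E/ℚ) + corank Sel_{p^∞}(E^{(c)}/ℚ) ≤ λ(X(E/ℚ_∞))` for `√c ∈ ℚ_∞` — Greenberg's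
# Theorem 1.9 (Selmer-corank clause) at a quadratic layer, PROVED inside one algebraic closure;
# conjunct (d) of the `TwoAdicLambdaTransport` fact pack becomes a theorem

Topic `NumberTheory/EllipticCurves`, sub-story `Greenberg1999`; literature seat `bsd-rank2-lit`
(cell `bsd-rank2`, gen 16) for the cell's planner `p2` (door (F\*) at `p = 2`, fact pack
`PublishedInputsAtTwo`), `eng-2` and `director-bsd`. PROOFS plus six auxiliary definitions WITH
BODIES (the transport maps `primaryEquiv`, `h1`, `localEquiv`, `plainRes`, `twistedRes`, `compMap`);
NO new named facts (D-0026: net debt `0`; the file does not use the named fact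
`thm19_selmerCorank_layer_le_lambdaInvariant` of the sibling `SelmerCorankLayerBound.lean`).

## What is proved

* `WeierstrassCurve.selmerCorank_add_selmerCorank_quadraticTwist_le_lambdaInvariant`: for an
  elliptic curve `E/ℚ` (`W`), a prime `p`, `c ∈ ℚˣ` with a square root `δ ∈ ℚ̄ ∖ ℚ` fixed by
  `ker κ = Gal(ℚ̄/ℚ_∞)` for a `ℤ_p`-extension `κ` of `ℚ` with topological generator `γ`, and a
  Pontryagin-dual datum `D` of `Sel_{p^∞}(E/ℚ_∞)` (tree: `SelmerDualData`, the in-closure Selmer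
  group `selmerInfty`) whose `X = D.X` is finitely generated and torsion over `Λ = ℤ_p⟦T⟧`:
  `s_p(E/ℚ) + s_p(E^{(c)}/ℚ) ≤ λ(X) := dim_{ℚ_p} (ℚ_p ⊗_{ℤ_p} X)` (`lambdaInvariant`), where
  `s_p = corank_{ℤ_p} Sel_{p^∞}(·/ℚ)` is the tree's `selmerCorank` (in-closure rendering
  `selmerGroupPInfty`). No reduction hypothesis at `p`, no cyclotomicity.
* `Greenberg1999.selmerCorank_add_selmerCorank_quadraticTwist_two_le_lambda_of_isCyclotomic`:
  `p = 2`, `c = 2`, `κ` CYCLOTOMIC: `s₂(E/ℚ) + s₂(E^{(2)}/ℚ) ≤ D.lambda` for every `Λ`-torsion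
  dual datum `D` (`√2 ∈ ℚ_1 ⊆ ℚ_∞`: `ZpExtension.IsCyclotomic.exists_sq_eq_two_layer_one`;
  `X` f.g.: `SelmerDualData.module_finite_of_isCyclotomic`).
* `Greenberg1999.selmerCorank_add_selmerCorank_quadraticTwist_two_le_of_isOrdinaryAt`: the same,
  verbatim in the binders of conjunct (d) of `PublishedInputsAtTwo` — the type of the hypothesis
  `h19` of `Summit.BirchSwinnertonDyer.Rank2.Family81517.publishedInputsAtTwo_of_facts`
  (`Summits/BirchSwinnertonDyer/Rank2/TwoAdicLambdaTransportInputs.lean`), which the sibling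
  `SelmerCorankLayerBoundAtTwoProofs.lean` derives from the NAMED FACT
  `thm19_selmerCorank_layer_le_lambdaInvariant`; here it is a closed theorem
  (axioms `propext`, `Classical.choice`, `Quot.sound`), so `h19` can be fed without any fact.

## The printed proof and how this file follows it

Greenberg, LNM 1716, Thm. 1.9 (PDF p. 63): for a `ℤ_p`-extension `F_∞/F` with `Sel_E(F_∞)_p`
`Λ`-cotorsion, `corank_{ℤ_p} Sel_E(F_n)_p ≤ λ_E`; "This result follows from the fact that the maps
`Sel_E(F_n)_p → Sel_E(F_∞)_p` have finite kernel" (ibid.), the kernel being finite by §3 Lemma 3.1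
(PDF p. 86; the argument is spelled out again in the proof of Prop. 3.10, PDF p. 98, where only
`Λ`-cotorsion is assumed). Dokchitser–Dokchitser (Ann. of Math. 172 (2010)), Lemma 4.14 (p. 590)
with its use on p. 593 (`X_p(E/K) = X^H`): for `F = K(√α)`,
`rk_p(E/F) = rk_p(E/K) + rk_p(E_α/K)`. Together, at the layer `F = ℚ(√c) ⊆ ℚ_∞`:
`s_p(E/ℚ) + s_p(E^{(c)}/ℚ) = s_p(E/ℚ(√c)) ≤ λ(X(E/ℚ_∞))`.

The tree states Selmer groups over `ℚ` and over `ℚ_∞ = ℚ̄^{ker κ}` inside ONE algebraic closure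
(`selmerGroupPInfty`, `selmerGroupOver`/`selmerInfty`), but has no comparison between these and
the own-completion rendering over the number field `ℚ(√c)`; so instead of passing through
`Sel(E/ℚ(√c))` the file proves the combined inequality directly, with the same two ingredients:

1. (Dokchitser–Dokchitser's decomposition, in-closure.) The twisting `ℚ̄`-isomorphism
   `ψ : E^{(c)} ≅ E` (`GeomTransport.ofQuadraticTwist`, Silverman X.5 Cor. 5.4 / X.2 Ex. 2.4) is
   defined over `ℚ(δ)`, hence equivariant for `ker κ ∋ σ` (`σ δ = δ`) and ANTI-equivariant
   (`ψ(σ x) = -σ ψ(x)`) for `σ δ = -δ`. It transports `E^{(c)}[p^∞] ≅ E[p^∞]` (`primaryEquiv`),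
   `H¹(ℚ_∞, E^{(c)}[p^∞]) ≅ H¹(ℚ_∞, E[p^∞])` (`h1`, via `h1Equiv`), the local points and local
   Kummer conditions at every place of `ℚ̄` (`localEquiv`, `mem_localKerOverOfEmb_iff`), hence
   `Sel_{p^∞}(E^{(c)}/ℚ_∞) ≅ Sel_{p^∞}(E/ℚ_∞)` (`h1_mem_selmerGroupOver`), and commutes with the
   conjugation action of `Γ_ℚ` up to the sign `±` (`conjH1_h1`, `conjH1_h1_of_smul_eq_neg`).
   The comparison map `Θ(η, η') = res η + ψ_* res η' : Sel(E/ℚ) × Sel(E^{(c)}/ℚ) → Sel(E/ℚ_∞)`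
   (`compMap`; T. Dokchitser's `X = X⁺ ⊕ X⁻`, Notes on the parity conjecture §4) has finite
   kernel (`finite_ker_compMap`): for `σm δ = -δ`, conjugation by `σm` fixes `res η` and negates
   `ψ_* res η'`, so `Θ(η, η') = 0` forces `2 res η = 0 = 2 res η'`, and one concludes by
   Greenberg's Lemma 3.1 (tree theorem `finite_subgroupResKer_kerSubgroup`) and the finiteness
   of the `2`-torsion of the Selmer groups (`finite_torsionBy_selmerGroupPInfty`).
2. (Greenberg's count.) `SelmerDualData.zpCorank_le_lambdaInvariant_of_finite_ker`: a `p`-primary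
   group `A` with finite `A[p]` mapping to `Sel_{p^∞}(E/ℚ_∞)` with finite kernel has
   `corank_{ℤ_p} A ≤ dim_{ℚ_p}(ℚ_p ⊗ X)`: `corank A` independent elements of `ℚ_p ⊗ X` are
   produced from the divisible part of `A` through the Pontryagin pairing of `D` (`toDual`,
   `toDual_C_smul`) — the dual form of "`corank Sel_E(F_n)_p ≤ rank_{ℤ_p} X/ω_n X ≤ λ`".
   Additivity `zpCorank_prod` then gives the sum.

§6 specialises to `p = 2`, `c = 2`: `√2 ∈ ℚ_1` (Washington §13.1; tree
`CyclotomicZpExtensionLayerOneSqrtTwoProofs`) is fixed by `ker κ ≤ Gal(ℚ̄/ℚ_1)`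
(`ZpExtension.kerSubgroup_le_layerSubgroup`), and `√2 ∉ ℚ` (`irrational_sqrt_two`).

Implementation note: all transport lemmas are stated for a VARIABLE `T : GeomTransport W' W ℚ`
with the curves written `W'⁄ℚ`, `W⁄ℚ` (definitionally `W'`, `W`), and `T` is instantiated to
`ofQuadraticTwist` only in the final theorem through the tree lemmas `ofQuadraticTwist_C_map_eq` and
`smul_equiv_ofQuadraticTwist_of_smul_eq_neg` (unfolding the concrete transport inside the cocycle
computations makes the kernel time out).

## References

* R. Greenberg, *Iwasawa theory for elliptic curves*, in: Arithmetic theory of elliptic curves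
  (Cetraro 1997), LNM **1716**, Springer 1999, 51–144 — Thm. 1.9 (§1, PDF p. 63), §3 Lemma 3.1
  (PDF p. 86), proof of Prop. 3.10 (PDF p. 98) [bib `GreenbergLNM1716`].
* T. Dokchitser, V. Dokchitser, *On the Birch–Swinnerton-Dyer quotients modulo squares*, Ann. of
  Math. **172** (2010), 567–596 — Lemma 4.14 (p. 590) and p. 593 [bib `DokchitserDokchitserAnnals2010`].
* T. Dokchitser, *Notes on the parity conjecture*, in: Elliptic curves, Hilbert modular forms and
  Galois deformations, Birkhäuser 2013 — §4 (quadratic twists, `X(E/K(√α)) = X⁺ ⊕ X⁻`)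
  [bib `Dokchitser2013ParityNotes`].
* J. H. Silverman, *The Arithmetic of Elliptic Curves*, GTM 106 (2nd ed. 2009) — X.2 Example 2.4,
  X.5 Cor. 5.4 (quadratic twists) [bib `SilvermanAEC2009`]; *Advanced Topics*, GTM 151 (1994) —
  V.5.2 [bib `SilvermanATAEC1994`].
* L. C. Washington, *Introduction to Cyclotomic Fields*, GTM 83 (2nd ed. 1997) — §13.1
  [bib `Washington1997`].
-/


noncomputable section

open scoped Classical TensorProduct AddSubgroup

open WeierstrassCurve WeierstrassCurve.VariableChange Literature.NumberTheory.EllipticCurves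
  Literature.NumberTheory.GaloisRepresentations Literature.NumberTheory.EllipticCurves.ResKernel

universe u

namespace WeierstrassCurve.SelmerDualData

variable {K : Type u} [Field K] [NumberField K] {W : WeierstrassCurve K} {p : ℕ} [Fact p.Prime]
  {κ : ZpExtension K p} {γ : Field.absoluteGaloisGroup K}

/-- `(n % M) • y = n • y` when `M • y = 0`. [folklore] -/
private theorem mod_nsmul_eq_nsmul {B : Type*} [AddCommGroup B] {y : B} {M : ℕ} (hM : M • y = 0)
    (n : ℕ) : (n % M) • y = n • y := by
  conv_rhs => rw [← Nat.div_add_mod n M, add_nsmul, mul_nsmul, hM, smul_zero, zero_add]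

/-- A finite `𝔽_p`-vector space `V` has `p ^ dim V` elements, a basis `b_i` and "dual characters"
`f_j : V → ℚ/ℤ` with `f_j(b_i) = δ_{ji} e` for any `e ∈ ℚ/ℤ` killed by `p` (the coordinate
functionals followed by `1 ↦ e`). [folklore] -/
private theorem exists_dual_family {V : Type*} [AddCommGroup V] [Module (ZMod p) V] [Finite V]
    {e : AddCircle (1 : ℚ)} (he : p • e = 0) :
    ∃ (ρ : ℕ) (b : Fin ρ → V) (f : Fin ρ → (V →+ AddCircle (1 : ℚ))),
      Nat.card V = p ^ ρ ∧ ∀ j i, f j (b i) = if j = i then e else 0 := by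
  haveI : Module.Finite (ZMod p) V := Module.Finite.of_finite
  let bs := Module.finBasis (ZMod p) V
  let g : ZMod p →+ AddCircle (1 : ℚ) :=
    ZMod.lift p ⟨zmultiplesHom _ e, by simp [natCast_zsmul, he]⟩
  have hg : ∀ x : ZMod p, g x = x.val • e := by
    intro x
    have h : g ((x.val : ℤ) : ZMod p) = (x.val : ℤ) • e := by
      rw [ZMod.lift_coe]; exact zmultiplesHom_apply _ e _
    rwa [Int.cast_natCast, ZMod.natCast_zmod_val, natCast_zsmul] at h
  refine ⟨Module.finrank (ZMod p) V, bs, fun j ↦ g.comp (bs.coord j).toAddMonoidHom, ?_, fun j i ↦ ?_⟩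
  · rw [Module.natCard_eq_pow_finrank (K := ZMod p) (V := V), Nat.card_zmod]
  · simp only [AddMonoidHom.coe_comp, LinearMap.toAddMonoidHom_coe, Function.comp_apply,
      Module.Basis.coord_apply, Module.Basis.repr_self, hg]
    by_cases h : j = i
    · subst h; rw [Finsupp.single_eq_same, if_pos rfl, ZMod.val_one, one_smul]
    · rw [Finsupp.single_eq_of_ne h, if_neg h, ZMod.val_zero, zero_smul]

/-- **Pontryagin rank bound.** Let `D` be a Pontryagin-dual datum of `Sel_{p^∞}(E/K_∞)` with
`X = D.X` finitely generated and torsion over `Λ`, and let `A` be a `p`-primary abelian group with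
finite `p`-torsion mapping to `Sel_{p^∞}(E/K_∞)` with finite kernel. Then
`corank_{ℤ_p} A ≤ λ(X) = dim_{ℚ_p} ℚ_p ⊗_{ℤ_p} X`. Proof (Greenberg 1999, proof of Thm. 1.9, made
explicit): the divisible part `C = p^k A` of `A` has `#C[p] = p^ρ`, `ρ = corank A`
(`pow_zpCorank_eq_natCard_torsionBy_inf_range_of_stable`); an `𝔽_p`-basis `b_i` of `C[p]` with
dual characters `φ_i` (extended to `A` by the injectivity of `ℚ/ℤ`) and `p^N`-th roots
`p^N u_{i,N} = b_i` in `C` give, after multiplying by `p^a` (killing `ker Θ`), characters of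
`Θ(A) ⊆ Sel_∞`, hence elements `x_i ∈ X` (`toDual` bijective); a `ℤ_p`-relation `∑ g_i x_i = 0`
evaluated at `Θ(u_{i,m+a})` (`toDual_C_smul`) shows `p^m ∣ g_i ⇒ p^{m+1} ∣ g_i`, so `g = 0`: the
`x_i` are independent in `ℚ_p ⊗ X`, which is finite-dimensional for `X` f.g. torsion
(`IwasawaAlgebra.finite_baseChange_of_isTorsion`).
[cite: GreenbergLNM1716, Thm. 1.9 (§1, PDF p. 63) with §3 Lemma 3.1] -/
theorem zpCorank_le_lambdaInvariant_of_finite_ker (D : W.SelmerDualData κ γ)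
    [Module.Finite (IwasawaAlgebra p) D.X] (hD : D.IsTorsion)
    {A : Type*} [AddCommGroup A] (hA : ∀ a : A, ∃ n : ℕ, p ^ n • a = 0) [Finite A[(p : ℤ)]]
    (Θ : A →+ W.selmerInfty κ) [Finite Θ.ker] :
    zpCorank A p ≤ lambdaInvariant p D.X := by
  have hp := (Fact.out : p.Prime)
  -- (1) the divisible part `C = p^k A` and its `p`-torsion `V`
  obtain ⟨k, hst⟩ := exists_torsionBy_inf_range_stable (A := A) p
  set C : AddSubgroup A := (nsmulAddMonoidHom (α := A) (p ^ k)).range with hCdef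
  set V : AddSubgroup A := A[(p : ℤ)] ⊓ C with hVdef
  have hcard : p ^ zpCorank A p = Nat.card V :=
    pow_zpCorank_eq_natCard_torsionBy_inf_range_of_stable p hA hst
  have hVp' : ∀ v : V, p • (v : A) = 0 := fun v ↦ AddSubgroup.torsionBy.nsmul_iff.mp v.2.1
  have hVp : ∀ v : V, p • v = 0 := fun v ↦ Subtype.ext (by
    rw [AddSubgroupClass.coe_nsmul, hVp' v, ZeroMemClass.coe_zero])
  letI : Module (ZMod p) V := AddCommGroup.zmodModule hVp
  haveI : Finite V := Finite.of_injective (fun v : V ↦ (⟨v.1, v.2.1⟩ : A[(p : ℤ)]))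
    (by intro a b h; exact Subtype.ext (by simpa using congrArg Subtype.val h))
  -- (2) an element `e₁ ∈ ℚ/ℤ` of order `p`; a basis `b` of `V` with dual characters `χV`
  obtain ⟨c₀, hc₀⟩ := exists_character_prufGen p
  set e₁ : AddCircle (1 : ℚ) := c₀ (prufGen p 1) with he₁def
  have he₁ : addOrderOf e₁ = p := by rw [he₁def, hc₀ 1, pow_one]
  have hpe₁ : p • e₁ = 0 := by rw [← he₁]; exact addOrderOf_nsmul_eq_zero e₁
  obtain ⟨ρ, b, χV, hcardV, hχV⟩ := exists_dual_family (p := p) (V := V) hpe₁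
  have hρeq : zpCorank A p = ρ := by
    rw [hcardV] at hcard
    exact Nat.pow_right_injective hp.two_le hcard
  have hext : ∀ j, ∃ φ : A →+ AddCircle (1 : ℚ), ∀ v : V, φ v = χV j v := by
    intro j
    obtain ⟨φ, hφ⟩ := CharacterModule.dual_surjective_of_injective V.subtype.toIntLinearMap
      (fun a b h ↦ Subtype.ext h) (χV j)
    refine ⟨φ, fun v ↦ ?_⟩
    have := DFunLike.congr_fun hφ v
    rw [CharacterModule.dual_apply] at this
    exact this
  choose φ hφ using hext
  -- (3) `p^N`-th roots in the divisible group `C`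
  have hdiv : ∀ c : C, ∃ c' : C, p • (c' : A) = c := fun c ↦ by
    obtain ⟨m, hm⟩ := hA c
    obtain ⟨c', hc', h⟩ := exists_nsmul_eq_of_stable p hst m c c.2 hm
    exact ⟨⟨c', hc'⟩, h⟩
  choose dv hdv using hdiv
  let u : V → ℕ → C := fun v N ↦ dv^[N] ⟨v, v.2.2⟩
  have hu0 : ∀ v : V, ((u v 0 : C) : A) = v := fun v ↦ by
    simp only [u, Function.iterate_zero, id_eq]
  have huS : ∀ (v : V) (N : ℕ), u v (N + 1) = dv (u v N) := fun v N ↦ by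
    simp only [u, Function.iterate_succ_apply']
  have hu : ∀ (v : V) (N : ℕ), p ^ N • ((u v N : C) : A) = v := by
    intro v N
    induction N with
    | zero => rw [pow_zero, one_nsmul, hu0]
    | succ N ih => rw [huS, pow_succ, mul_nsmul', hdv, ih]
  have hu' : ∀ (v : V) (N : ℕ), p ^ (N + 1) • ((u v N : C) : A) = 0 := by
    intro v N
    rw [pow_succ, mul_nsmul, hu, hVp']
  -- (4) one power `p^a` kills `ker Θ`
  obtain ⟨a, ha⟩ := exists_uniform_pow_smul_eq_zero p (Θ.ker : Set A) (Set.toFinite _)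
    (fun s _ ↦ hA s)
  -- (5) characters `p^a φ_j` descend to `Θ(A)`, extend to `Sel_∞`, lift to `X`
  let χ' : Fin ρ → (A →+ AddCircle (1 : ℚ)) := fun j ↦ (nsmulAddMonoidHom (p ^ a)).comp (φ j)
  have hχ' : ∀ j t, χ' j t = p ^ a • φ j t := fun _ _ ↦ rfl
  have hker : ∀ j, Θ.rangeRestrict.ker ≤ (χ' j).ker := by
    intro j t ht
    rw [AddMonoidHom.mem_ker] at ht ⊢
    have ht' : t ∈ Θ.ker := by
      rw [AddMonoidHom.mem_ker]
      exact congrArg (fun z : Θ.range ↦ (z : W.selmerInfty κ)) ht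
    rw [hχ', ← map_nsmul, ha t ht', map_zero]
  have hsurj : Function.Surjective Θ.rangeRestrict := AddMonoidHom.rangeRestrict_surjective Θ
  let ψ : Fin ρ → (Θ.range →+ AddCircle (1 : ℚ)) := fun j ↦
    Θ.rangeRestrict.liftOfSurjective hsurj ⟨χ' j, hker j⟩
  have hψ : ∀ j t, ψ j (Θ.rangeRestrict t) = χ' j t := fun j t ↦
    AddMonoidHom.liftOfRightInverse_comp_apply _ _ _ _ t
  have hext' : ∀ j, ∃ xt : W.selmerInfty κ →+ AddCircle (1 : ℚ), ∀ s : Θ.range, xt s = ψ j s := by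
    intro j
    obtain ⟨xt, hxt⟩ := CharacterModule.dual_surjective_of_injective
      (Θ.range.subtype.toIntLinearMap) (fun a b h ↦ Subtype.ext h) (ψ j)
    refine ⟨xt, fun s ↦ ?_⟩
    have := DFunLike.congr_fun hxt s
    rw [CharacterModule.dual_apply] at this
    exact this
  choose xt hxt using hext'
  have hX : ∀ j, ∃ x : D.X, D.toDual x = xt j := fun j ↦ D.bijective.2 (xt j)
  choose x hx using hX
  have hval : ∀ j (t : A), xt j (Θ t) = p ^ a • φ j t := by
    intro j t
    have e1 : Θ t = ((Θ.rangeRestrict t : Θ.range) : W.selmerInfty κ) := rfl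
    rw [e1, hxt j, hψ j, hχ']
  -- `ℤ_p`-module structure on `X` through the constants `C : ℤ_p → Λ`
  letI : Module ℤ_[p] D.X := Module.compHom D.X (algebraMap ℤ_[p] (IwasawaAlgebra p))
  haveI : IsScalarTower ℤ_[p] (IwasawaAlgebra p) D.X := IsScalarTower.of_compHom ℤ_[p] _ _
  -- (6) the family `x` is `ℤ_p`-independent
  have hli : LinearIndependent ℤ_[p] x := by
    rw [Fintype.linearIndependent_iff]
    intro gc hg
    have hsum : (∑ j, gc j • x j) = ∑ j, (PowerSeries.C (gc j) : IwasawaAlgebra p) • x j := by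
      refine Finset.sum_congr rfl fun j _ ↦ ?_
      change (algebraMap ℤ_[p] (IwasawaAlgebra p) (gc j)) • x j = _
      rw [PowerSeries.algebraMap_eq]
    rw [hsum] at hg
    -- evaluation of the relation at a test element `t` with `p^N t = 0`
    have heval : ∀ (t : A) (N : ℕ), p ^ N • t = 0 →
        ∑ j, (PadicInt.toZModPow N (gc j)).val • (p ^ a • φ j t) = 0 := by
      intro t N hN
      have hsN : p ^ N • Θ t = 0 := by rw [← map_nsmul, hN, map_zero]
      have h1 := congrArg (fun w ↦ D.toDual w (Θ t)) hg
      beta_reduce at h1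
      rw [map_zero, AddMonoidHom.zero_apply, map_sum, AddMonoidHom.finsetSum_apply] at h1
      simp_rw [fun j ↦ D.toDual_C_smul (gc j) (x j) (Θ t) N hsN, hx, hval] at h1
      exact h1
    -- `p^m ∣ g_i` for every `m`, by induction
    have key : ∀ m : ℕ, ∀ i, (p : ℤ_[p]) ^ m ∣ gc i := by
      intro m
      induction m with
      | zero => intro i; rw [pow_zero]; exact one_dvd _
      | succ m ih =>
        intro i
        choose h hh using ih
        set N := m + a + 1 with hNdef
        -- the test element `t = u_{b i, m+a}`: `p^(m+a) t = b i`, `p^N t = 0`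
        set t : A := ((u (b i) (m + a) : C) : A) with htdef
        have ht1 : p ^ (m + a) • t = (b i : A) := hu (b i) (m + a)
        have ht0 : p ^ N • t = 0 := hu' (b i) (m + a)
        have hsum0 := heval t N ht0
        -- each term: `(g_j mod p^N).val • p^a φ_j t = (h_j mod p^N).val • φ_j (b i)`
        have hpm_lt : p ^ m < p ^ N := Nat.pow_lt_pow_right hp.one_lt (by omega)
        have hterm : ∀ j, (PadicInt.toZModPow N (gc j)).val • (p ^ a • φ j t) =
            (PadicInt.toZModPow N (h j)).val • χV j (b i) := by
          intro j
          have hord : p ^ N • (p ^ a • φ j t) = 0 := by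
            rw [smul_comm, ← map_nsmul, ht0, map_zero, smul_zero]
          have hpa : p ^ m • (p ^ a • φ j t) = χV j (b i) := by
            rw [smul_smul, ← pow_add, ← map_nsmul, ht1, hφ]
          rw [hh j, map_mul, map_pow, map_natCast, ZMod.val_mul, mod_nsmul_eq_nsmul hord,
            ← Nat.cast_pow, ZMod.val_cast_of_lt hpm_lt, mul_comm, mul_nsmul', hpa]
        simp_rw [hterm, hχV] at hsum0
        rw [Finset.sum_eq_single i (fun j _ hj ↦ by rw [if_neg hj, smul_zero])
          (fun hi ↦ (hi (Finset.mem_univ i)).elim), if_pos rfl] at hsum0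
        -- so `p ∣ (h_i mod p^N).val`, i.e. `h_i ≡ 0 (mod p)`
        have hdvd : p ∣ (PadicInt.toZModPow N (h i)).val := by
          have hd := addOrderOf_dvd_of_nsmul_eq_zero hsum0
          rwa [he₁] at hd
        have h1 : PadicInt.toZModPow 1 (h i) = 0 := by
          rw [← PadicInt.zmod_cast_comp_toZModPow 1 N (by omega), RingHom.comp_apply,
            ZMod.castHom_apply, ZMod.cast_eq_val, ZMod.natCast_eq_zero_iff]
          rwa [pow_one]
        have h2 : (p : ℤ_[p]) ^ 1 ∣ h i := by
          rw [← Ideal.mem_span_singleton, ← PadicInt.ker_toZModPow, RingHom.mem_ker]; exact h1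
        obtain ⟨h', hh'⟩ := h2
        refine ⟨h', ?_⟩
        rw [hh i, hh', pow_one, pow_succ]; ring
    intro i
    refine padicInt_eq_zero_of_forall_dvd (gc i) one_ne_zero fun N ↦ ?_
    have hN : PadicInt.toZModPow N (gc i) = 0 := by
      rw [← RingHom.mem_ker, PadicInt.ker_toZModPow, Ideal.mem_span_singleton]; exact key N i
    rw [hN, ZMod.val_zero, zero_mul]
    exact dvd_zero _
  -- (7) pass to `ℚ_p ⊗_{ℤ_p} X`
  haveI : Module.Finite ℚ_[p] (ℚ_[p] ⊗[ℤ_[p]] D.X) :=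
    IwasawaAlgebra.finite_baseChange_of_isTorsion p hD
  have hli' : LinearIndependent ℚ_[p] ((TensorProduct.mk ℤ_[p] ℚ_[p] D.X 1) ∘ x) :=
    hli.of_isLocalizedModule ℚ_[p] (nonZeroDivisors ℤ_[p]) (TensorProduct.mk ℤ_[p] ℚ_[p] D.X 1)
  have hcard' := hli'.fintype_card_le_finrank
  rw [Fintype.card_fin] at hcard'
  rw [hρeq]
  unfold lambdaInvariant
  exact hcard'

end WeierstrassCurve.SelmerDualData


/-! ## Generic: conjugation commutes with the map of an equivariant isomorphism of coefficients -/

namespace Literature.NumberTheory.EllipticCurves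

section Generic

variable {G : Type u} [Group G] [TopologicalSpace G] [IsTopologicalGroup G]
variable {N : Subgroup G} [N.Normal] {c : G}
variable {M : Type u} [AddCommGroup M] [DistribMulAction G M] [TopologicalSpace M]
  [DiscreteTopology M]
variable {M' : Type u} [AddCommGroup M'] [DistribMulAction G M'] [TopologicalSpace M']
  [DiscreteTopology M']

/-- **Equivariance at `c` commutes `c_*` past `ψ_*`.** For `ψ : M' ≃ M` additive and
`N`-equivariant with `ψ (c • m') = c • ψ m'`, the induced `ψ_* : H¹(N, M') ≃ H¹(N, M)` satisfies
`ψ_* (c_* ξ') = c_* (ψ_* ξ')` (companion of the tree's `h1Equiv_conjH1_neg`).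
Serre, *Galois Cohomology*, I.§2.5. [folklore] -/
private theorem h1Equiv_conjH1_of_smul (ψ : M' ≃+ M) (hψ : ∀ (n : N) (m' : M'), ψ (n • m') = n • ψ m')
    (hψc : ∀ m' : M', ψ (c • m') = c • ψ m') (ξ' : subgroupH1 N M') :
    h1Equiv ψ hψ (conjH1 N M' c ξ') = conjH1 N M c (h1Equiv ψ hψ ξ') := by
  obtain ⟨f, rfl⟩ := oneCocycleClass_surjective _ ξ'
  rw [conjH1_oneCocycleClass, h1Equiv_apply, h1Equiv_apply, resH1Hom_id_oneCocycleClass,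
    resH1Hom_id_oneCocycleClass, conjH1_oneCocycleClass]
  congr 1
  apply Subtype.ext
  ext n
  rw [contOneCocycles.push_apply, conjCocycle_apply]
  change ψ (c • f.1 (subgroupConj N c n)) = (conjCocycle N c (contOneCocycles.push (ψ : M' →+ M) hψ f)).1 n
  rw [conjCocycle_apply, contOneCocycles.push_apply, hψc]
  rfl

/-- A homomorphism with finite kernel into a finite group has finite source. [folklore] -/
private theorem finite_of_finite_ker_of_finite {A B : Type*} [AddCommGroup A] [AddCommGroup B]
    (f : A →+ B) [Finite B] [Finite f.ker] : Finite A := by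
  have hs : ∀ b : f.range, ∃ a : A, f a = b := fun b ↦ b.2
  choose s hs using hs
  refine Finite.of_injective (fun a : A ↦
    ((⟨f a, a, rfl⟩ : f.range), (⟨a - s ⟨f a, a, rfl⟩, by
      rw [AddMonoidHom.mem_ker, map_sub, hs, sub_self]⟩ : f.ker))) ?_
  intro a a' h
  simp only [Prod.mk.injEq, Subtype.mk.injEq] at h
  obtain ⟨h1, h2⟩ := h
  have e : s ⟨f a, a, rfl⟩ = s ⟨f a', a', rfl⟩ := by
    congr 1; exact Subtype.ext h1
  rw [e] at h2
  exact sub_left_injective h2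

end Generic

end Literature.NumberTheory.EllipticCurves

/-! ## A `ℚ̄`-isomorphism `E'_{ℚ̄} ≅ E_{ℚ̄}` twisted by a quadratic character, on `p^∞`-torsion and
## on local points

Throughout, `T : GeomTransport W' W ℚ` is a change of variables over `ℚ̄` carrying `E' = W'⁄ℚ` to
`E = W⁄ℚ` (the tree's `GeomTransport`; the curves appear through their base changes `W'⁄ℚ`, `W⁄ℚ`,
definitionally equal to `W'`, `W`), whose coefficients are fixed by every ring endomorphism of `ℚ̄`
fixing an element `δ` (`hC`), and which is anti-equivariant at the `σ ∈ Γ_ℚ` with `σ δ = -δ`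
(`hneg`); every `σ` moves `δ` to `± δ` (`hδ`). The quadratic-twist transport
`GeomTransport.ofQuadraticTwist` (`δ = √c`) is the case in point (`QuadraticTwist` section below). -/

namespace Literature.NumberTheory.EllipticCurves.GeomTransport

variable {W' W : WeierstrassCurve ℚ} (T : GeomTransport W' W ℚ) {δ : AlgebraicClosure ℚ}
  (hC : ∀ g : AlgebraicClosure ℚ →+* AlgebraicClosure ℚ, g δ = δ → T.C.map g = T.C)

include hC in
/-- `T (σ x) = σ T (x)` for `σ δ = δ` (`smul_equiv_of_map_eq`). [cite: SilvermanAEC2009, X.2 Thm. 2.2 (proof)] -/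
theorem equiv_smul_of_smul_eq' {σ : Field.absoluteGaloisGroup ℚ} (hσ : σ • δ = δ)
    (x : geomPoints (W'⁄ℚ)) : T.equiv (σ • x) = σ • T.equiv x :=
  (T.smul_equiv_of_map_eq (hC _ hσ) x).symm

variable (p : ℕ)

/-- The transport on `p`-primary torsion `E'[p^∞] ≃+ E[p^∞]`. [cite: SilvermanAEC2009, III.3.1(b)] -/
def primaryEquiv : geomPrimaryTorsion (W'⁄ℚ) p ≃+ geomPrimaryTorsion (W⁄ℚ) p :=
  primaryComponentCongr T.equiv p

/-- Values of `primaryEquiv`. [folklore] -/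
@[simp]
private theorem coe_primaryEquiv (m : geomPrimaryTorsion (W'⁄ℚ) p) :
    (T.primaryEquiv p m : geomPoints (W⁄ℚ)) = T.equiv (m : geomPoints (W'⁄ℚ)) :=
  rfl

variable (H : Subgroup (Field.absoluteGaloisGroup ℚ)) (hH : ∀ σ ∈ H, σ • δ = δ)

include hC hH in
/-- `primaryEquiv` is `H`-equivariant for every subgroup `H ≤ Γ_ℚ` fixing `δ`. [cite: SilvermanAEC2009, X.2 Thm. 2.2 (proof)] -/
theorem primaryEquiv_smul (g : H) (m : geomPrimaryTorsion (W'⁄ℚ) p) :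
    T.primaryEquiv p (g • m) = g • T.primaryEquiv p m := by
  apply Subtype.ext
  rw [coe_primaryEquiv, Subgroup.smul_def, Subgroup.smul_def, primaryComponent.coe_smul,
    primaryComponent.coe_smul, coe_primaryEquiv]
  exact T.equiv_smul_of_smul_eq' hC (hH g g.2) m

include hC in
/-- Equivariance at `σ` with `σ δ = δ`, on `p^∞`-torsion. [folklore] -/
private theorem primaryEquiv_smul_of_smul_eq {σ : Field.absoluteGaloisGroup ℚ} (hσ : σ • δ = δ)
    (m : geomPrimaryTorsion (W'⁄ℚ) p) :
    T.primaryEquiv p (σ • m) = σ • T.primaryEquiv p m := by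
  apply Subtype.ext
  rw [coe_primaryEquiv, primaryComponent.coe_smul, primaryComponent.coe_smul, coe_primaryEquiv]
  exact T.equiv_smul_of_smul_eq' hC hσ m

/-- Anti-equivariance at `σ`, on `p^∞`-torsion. [folklore] -/
private theorem primaryEquiv_smul_of_neg {σ : Field.absoluteGaloisGroup ℚ}
    (hσ : ∀ x : geomPoints (W'⁄ℚ), T.equiv (σ • x) = -(σ • T.equiv x))
    (m : geomPrimaryTorsion (W'⁄ℚ) p) :
    T.primaryEquiv p (σ • m) = -(σ • T.primaryEquiv p m) := by
  apply Subtype.ext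
  rw [coe_primaryEquiv, primaryComponent.coe_smul, NegMemClass.coe_neg, primaryComponent.coe_smul,
    coe_primaryEquiv]
  exact hσ m

/-- **`ψ_* : H¹(H, E'[p^∞]) ≃+ H¹(H, E[p^∞])`** for `H` fixing `δ`. [folklore] -/
def h1 : (W'⁄ℚ).subgroupH1 p H ≃+ (W⁄ℚ).subgroupH1 p H :=
  h1Equiv (T.primaryEquiv p) (T.primaryEquiv_smul hC p H hH)

/-! ### The local transport at a `ℚ`-field `E` along an embedding `ι : ℚ̄ → ℚ̄_E` -/

section Local

variable {E : Type} [Field E] [Algebra ℚ E] (ι : AlgebraicClosure ℚ →ₐ[ℚ] AlgebraicClosure E)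

/-- The transported change of variables `ι(C)` over `ℚ̄_E` still carries `E'` to `E`.
[cite: SilvermanATAEC1994, Lemma V.5.2 (c) (PDF p. 407)] -/
theorem map_smul_eq : T.C.map (ι : AlgebraicClosure ℚ →+* AlgebraicClosure E) •
    (W'⁄ℚ).baseChange (AlgebraicClosure E) = (W⁄ℚ).baseChange (AlgebraicClosure E) :=
  VariableChange.map_smul_baseChange_eq _ _ _ T.smul_eq ι

/-- **The local transport** `E'(ℚ̄_E) ≃+ E(ℚ̄_E)`: the change of variables `ι(C)`.
[cite: SilvermanATAEC1994, Lemma V.5.2 (c) (PDF p. 407)] -/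
def localEquiv : localPoints (W'⁄ℚ) E ≃+ localPoints (W⁄ℚ) E :=
  (VariableChange.pointEquiv ((W'⁄ℚ).baseChange (AlgebraicClosure E))
    (T.C.map (ι : AlgebraicClosure ℚ →+* AlgebraicClosure E))).trans
    (Affine.Point.congrEquiv (T.map_smul_eq ι))

/-- Unfolding `localEquiv` (definitional). [folklore] -/
private theorem localEquiv_apply (Q : localPoints (W'⁄ℚ) E) :
    T.localEquiv ι Q = Affine.Point.congrEquiv (T.map_smul_eq ι)
      (VariableChange.pointEquiv ((W'⁄ℚ).baseChange (AlgebraicClosure E))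
        (T.C.map (ι : AlgebraicClosure ℚ →+* AlgebraicClosure E)) Q) :=
  rfl

/-- Unfolding the transport on points (definitional). [folklore] -/
private theorem equiv_apply (x : geomPoints (W'⁄ℚ)) :
    T.equiv x = Affine.Point.congrEquiv T.smul_eq (VariableChange.pointEquiv _ T.C x) :=
  rfl

/-- Unfolding `pointsMapOfEmb` (definitional). [folklore] -/
private theorem pointsMapOfEmb_apply (V : WeierstrassCurve ℚ) (P : geomPoints V) :
    pointsMapOfEmb V ι P = Affine.Point.map ι P :=
  rfl

/-- **The local square**: `ι_* (T x) = T_ι (ι_* x)` (`VariableChange.map_congrEquiv_pointEquiv`).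
[cite: SilvermanATAEC1994, Lemma V.5.2 (c) (PDF p. 407)] -/
theorem pointsMapOfEmb_equiv (x : geomPoints (W'⁄ℚ)) :
    pointsMapOfEmb (W⁄ℚ) ι (T.equiv x) = T.localEquiv ι (pointsMapOfEmb (W'⁄ℚ) ι x) := by
  rw [pointsMapOfEmb_apply, pointsMapOfEmb_apply, equiv_apply, localEquiv_apply]
  exact VariableChange.map_congrEquiv_pointEquiv (W'⁄ℚ) (W⁄ℚ) T.C T.smul_eq ι (T.map_smul_eq ι) x

include hC hH in
/-- **The local transport is `H_E`-equivariant**: `τ ∈ H_E = ι⁻¹(H)` restricts to an element of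
`H`, which fixes `δ` and hence the coefficients of `C`; so `τ` fixes the coefficients of `ι(C)`
(`ι ∘ τ|_{ℚ̄} = τ ∘ ι`) and `VariableChange.map_congrEquiv_pointEquiv_of_map_eq` applies.
[cite: SilvermanATAEC1994, Lemma V.5.2 (c) (PDF p. 407)] -/
theorem localEquiv_smul (τ : localSubgroupOfEmb H ι) (Q : localPoints (W'⁄ℚ) E) :
    T.localEquiv ι (τ • Q) = τ • T.localEquiv ι Q := by
  rw [Subgroup.smul_def, Subgroup.smul_def, localPoints.smul_def, localPoints.smul_def]
  have hcomp : ((AlgEquiv.restrictScalars ℚ (show AlgebraicClosure E ≃ₐ[E] AlgebraicClosure E from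
        (τ : Field.absoluteGaloisGroup E)) : AlgebraicClosure E ≃ₐ[ℚ] AlgebraicClosure E) :
          AlgebraicClosure E →+* AlgebraicClosure E).comp
        (ι : AlgebraicClosure ℚ →+* AlgebraicClosure E) =
      (ι : AlgebraicClosure ℚ →+* AlgebraicClosure E).comp
        ((galHom (resGalOfEmb ι τ) : AlgebraicClosure ℚ →ₐ[ℚ] AlgebraicClosure ℚ) :
          AlgebraicClosure ℚ →+* AlgebraicClosure ℚ) := by
    ext x
    exact (apply_resGalAuxOfEmb_apply ι τ x).symm
  have hfix : (T.C.map (ι : AlgebraicClosure ℚ →+* AlgebraicClosure E)).map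
      ((AlgEquiv.restrictScalars ℚ (show AlgebraicClosure E ≃ₐ[E] AlgebraicClosure E from
        (τ : Field.absoluteGaloisGroup E)) : AlgebraicClosure E ≃ₐ[ℚ] AlgebraicClosure E) :
          AlgebraicClosure E →+* AlgebraicClosure E) =
      T.C.map (ι : AlgebraicClosure ℚ →+* AlgebraicClosure E) := by
    rw [VariableChange.map_map, hcomp, ← VariableChange.map_map]
    congr 1
    exact hC _ (hH _ ((mem_localSubgroupOfEmb_iff H ι τ).mp τ.2))
  rw [localEquiv_apply, localEquiv_apply]
  exact (VariableChange.map_congrEquiv_pointEquiv_of_map_eq (W'⁄ℚ) (W⁄ℚ) _ (T.map_smul_eq ι) _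
    hfix Q).symm

include hH in
/-- **Local conditions correspond under the transport**: a class of `H¹(H, E'[p^∞])` dies in
`H¹(H_E, E'(ℚ̄_E))` iff its transport dies in `H¹(H_E, E(ℚ̄_E))`
(`mem_resKer_iff_h1Equiv_mem` with the local square and the `H_E`-equivariance).
Silverman, *AEC*, X.§4 (Selmer groups are attached to `E/K`, not to an equation). [folklore] -/
private theorem mem_localKerOverOfEmb_iff (x : (W'⁄ℚ).subgroupH1 p H) :
    x ∈ (W'⁄ℚ).localKerOverOfEmb p H ι ↔ T.h1 hC p H hH x ∈ (W⁄ℚ).localKerOverOfEmb p H ι :=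
  mem_resKer_iff_h1Equiv_mem (resGalSubgroupOfEmb H ι)
    ((pointsMapOfEmb (W'⁄ℚ) ι).comp ((W'⁄ℚ).geomPrimaryTorsion p).subtype)
    (fun τ P ↦ by
      simp only [AddMonoidHom.coe_comp, AddSubgroup.coe_subtype, Function.comp_apply,
        Subgroup.smul_def, resGalSubgroupOfEmb_apply_coe, primaryComponent.coe_smul]
      exact pointsMapOfEmb_smul _ ι τ (P : geomPoints (W'⁄ℚ)))
    ((pointsMapOfEmb (W⁄ℚ) ι).comp ((W⁄ℚ).geomPrimaryTorsion p).subtype)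
    (fun τ P ↦ by
      simp only [AddMonoidHom.coe_comp, AddSubgroup.coe_subtype, Function.comp_apply,
        Subgroup.smul_def, resGalSubgroupOfEmb_apply_coe, primaryComponent.coe_smul]
      exact pointsMapOfEmb_smul _ ι τ (P : geomPoints (W⁄ℚ)))
    (T.primaryEquiv p) (T.primaryEquiv_smul hC p H hH) (T.localEquiv ι)
    (T.localEquiv_smul hC H hH ι) (fun m ↦ T.pointsMapOfEmb_equiv ι m) x

end Local

/-! ### `Sel_{p^∞}(E'/L) → Sel_{p^∞}(E/L)` for `L = ℚ̄^H ∋ δ` -/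

variable [H.Normal] (hδ : ∀ σ : Field.absoluteGaloisGroup ℚ, σ • δ = δ ∨ σ • δ = -δ)
  (hneg : ∀ σ : Field.absoluteGaloisGroup ℚ, σ • δ = -δ →
    ∀ x : geomPoints (W'⁄ℚ), T.equiv (σ • x) = -(σ • T.equiv x))

include hδ hneg in
/-- **`c_*` past `ψ_*`**: for every `σ ∈ Γ_ℚ`, `σ_* (ψ_* x) = ± ψ_* (σ_* x)`.
[cite: SilvermanAEC2009, X.2 Example 2.4] -/
theorem conjH1_h1 (σ : Field.absoluteGaloisGroup ℚ) (x : (W'⁄ℚ).subgroupH1 p H) :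
    (W⁄ℚ).conjH1 p H σ (T.h1 hC p H hH x) = T.h1 hC p H hH ((W'⁄ℚ).conjH1 p H σ x) ∨
      (W⁄ℚ).conjH1 p H σ (T.h1 hC p H hH x) = -T.h1 hC p H hH ((W'⁄ℚ).conjH1 p H σ x) := by
  rcases hδ σ with hσ | hσ
  · left
    exact (h1Equiv_conjH1_of_smul _ _ (T.primaryEquiv_smul_of_smul_eq hC p hσ) x).symm
  · right
    rw [h1, h1Equiv_conjH1_neg _ _ (T.primaryEquiv_smul_of_neg p (hneg σ hσ)) x, neg_neg]

include hδ hneg in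
/-- **The transport carries `Sel_{p^∞}(E'/L)` into `Sel_{p^∞}(E/L)`** for `L = ℚ̄^H` with
`δ ∈ L` (`H` normal, fixing `δ`): every local condition at every place corresponds
(`mem_localKerOverOfEmb_iff`), and conjugation by `σ ∈ Γ_ℚ` commutes with the transport up to sign
(`conjH1_h1`). Silverman, *AEC*, X.§4; Greenberg (1999), §2. [cite: GreenbergLNM1716, §2] -/
theorem h1_mem_selmerGroupOver {x : (W'⁄ℚ).subgroupH1 p H} (hx : x ∈ (W'⁄ℚ).selmerGroupOver p H) :
    T.h1 hC p H hH x ∈ (W⁄ℚ).selmerGroupOver p H := by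
  rw [mem_selmerGroupOver_iff] at hx ⊢
  refine ⟨fun v σ ↦ ?_, fun w σ ↦ ?_⟩
  · have h := (T.mem_localKerOverOfEmb_iff hC p H hH (closureEmb (K := ℚ) (v.adicCompletion ℚ))
      _).mp (hx.1 v σ)
    rcases T.conjH1_h1 hC p H hH hδ hneg σ x with e | e
    · rw [e]; exact h
    · rw [e]; exact neg_mem h
  · have h := (T.mem_localKerOverOfEmb_iff hC p H hH (closureEmb (K := ℚ) w.Completion) _).mp
      (hx.2 w σ)
    rcases T.conjH1_h1 hC p H hH hδ hneg σ x with e | e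
    · rw [e]; exact h
    · rw [e]; exact neg_mem h

end Literature.NumberTheory.EllipticCurves.GeomTransport

/-! ## The comparison map `Sel_{p^∞}(E/ℚ) × Sel_{p^∞}(E'/ℚ) → Sel_{p^∞}(E/ℚ_∞)` and the corank bound -/

namespace Literature.NumberTheory.EllipticCurves.GeomTransport

variable {W' W : WeierstrassCurve ℚ} (T : GeomTransport W' W ℚ) {δ : AlgebraicClosure ℚ}
  (hC : ∀ g : AlgebraicClosure ℚ →+* AlgebraicClosure ℚ, g δ = δ → T.C.map g = T.C)
  (hδ : ∀ σ : Field.absoluteGaloisGroup ℚ, σ • δ = δ ∨ σ • δ = -δ)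
  (hneg : ∀ σ : Field.absoluteGaloisGroup ℚ, σ • δ = -δ →
    ∀ x : geomPoints (W'⁄ℚ), T.equiv (σ • x) = -(σ • T.equiv x))
  (p : ℕ) [Fact p.Prime] {κ : ZpExtension ℚ p} {γ : Field.absoluteGaloisGroup ℚ}
  (hκ : ∀ σ ∈ κ.kerSubgroup, σ • δ = δ)

include hneg in
/-- For `σ δ = -δ`: `σ_* (ψ_* x) = -ψ_* (σ_* x)` over `ℚ_∞ = ℚ̄^{ker κ}`. [cite: SilvermanAEC2009, X.2 Example 2.4] -/
theorem conjH1_h1_of_smul_eq_neg {σ : Field.absoluteGaloisGroup ℚ} (hσ : σ • δ = -δ)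
    (x : (W'⁄ℚ).subgroupH1 p κ.kerSubgroup) :
    (W⁄ℚ).conjH1 p κ.kerSubgroup σ (T.h1 hC p κ.kerSubgroup hκ x) =
      -T.h1 hC p κ.kerSubgroup hκ ((W'⁄ℚ).conjH1 p κ.kerSubgroup σ x) := by
  rw [h1, h1Equiv_conjH1_neg _ _ (T.primaryEquiv_smul_of_neg p (hneg σ hσ)) x, neg_neg]

/-- **`Θ₁ : Sel_{p^∞}(E/ℚ) → Sel_{p^∞}(E/ℚ_∞)`**, restriction (Greenberg's `s_0`).
[cite: GreenbergLNM1716, §1 and §3 Lemma 3.1] -/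
def plainRes : selmerGroupPInfty (W⁄ℚ) p →+ (W⁄ℚ).selmerInfty κ :=
  (((W⁄ℚ).resInfty p κ).comp (selmerGroupPInfty (W⁄ℚ) p).subtype).codRestrict _
    fun η ↦ (W⁄ℚ).resInfty_mem_selmerInfty κ η.2

include hδ hneg in
/-- **`Θ₂ : Sel_{p^∞}(E'/ℚ) → Sel_{p^∞}(E/ℚ_∞)`**, restriction followed by the transport `ψ_*`
(lands in `Sel_∞(E)` by `h1_mem_selmerGroupOver`, `δ ∈ ℚ_∞`). [cite: GreenbergLNM1716, §2] -/
def twistedRes : selmerGroupPInfty (W'⁄ℚ) p →+ (W⁄ℚ).selmerInfty κ :=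
  ((T.h1 hC p κ.kerSubgroup hκ).toAddMonoidHom.comp
    (((W'⁄ℚ).resInfty p κ).comp (selmerGroupPInfty (W'⁄ℚ) p).subtype)).codRestrict _
    fun η' ↦ T.h1_mem_selmerGroupOver hC p κ.kerSubgroup hκ hδ hneg
      ((W'⁄ℚ).resInfty_mem_selmerInfty κ η'.2)

include hδ hneg in
/-- **The comparison map `Θ : Sel_{p^∞}(E/ℚ) × Sel_{p^∞}(E'/ℚ) → Sel_{p^∞}(E/ℚ_∞)`**,
`(η, η') ↦ res η + ψ_* res η'` (T. Dokchitser 2013, §4: `X(E/K(√α)) = X⁺ ⊕ X⁻`, here read over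
`ℚ_∞ ⊇ ℚ(δ)`). [cite: Dokchitser2013ParityNotes, §4 (proof of Thm. [Squarity, NekIV, Kurast])] -/
def compMap : selmerGroupPInfty (W⁄ℚ) p × selmerGroupPInfty (W'⁄ℚ) p →+ (W⁄ℚ).selmerInfty κ :=
  (plainRes p).coprod (T.twistedRes hC hδ hneg p hκ)

/-- Values of `compMap` in `H¹(ℚ_∞, E[p^∞])`. [folklore] -/
private theorem coe_compMap (x : selmerGroupPInfty (W⁄ℚ) p × selmerGroupPInfty (W'⁄ℚ) p) :
    ((T.compMap hC hδ hneg p hκ x : (W⁄ℚ).selmerInfty κ) : (W⁄ℚ).subgroupH1 p κ.kerSubgroup) =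
      (W⁄ℚ).resInfty p κ (x.1 : galH1Primary (W⁄ℚ) p) +
        T.h1 hC p κ.kerSubgroup hκ ((W'⁄ℚ).resInfty p κ (x.2 : galH1Primary (W'⁄ℚ) p)) :=
  rfl

omit [Fact p.Prime] in
/-- `Sel_{p^∞}(E/ℚ)` is `p`-primary. Greenberg (1999), §1. [folklore] -/
private theorem primary_selmerGroupPInfty (V : WeierstrassCurve ℚ) (η : selmerGroupPInfty V p) :
    ∃ n : ℕ, p ^ n • η = 0 := by
  obtain ⟨k, hk⟩ := exists_pow_nsmul_eq_zero_galH1Primary V p (η : galH1Primary V p)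
  exact ⟨k, Subtype.ext (by rw [AddSubgroupClass.coe_nsmul, hk]; rfl)⟩

variable [(W'⁄ℚ).IsElliptic] [(W⁄ℚ).IsElliptic]

include hδ hneg in
/-- **`ker Θ` is finite.** Conjugation by `σm` with `σm δ = -δ` fixes restricted classes
(`conjH1_resInfty`) and negates transported ones (`conjH1_h1_of_smul_eq_neg`), so
`Θ(η, η') = 0` forces `2 res η = 0 = 2 res η'`; the restrictions `H¹(ℚ, ·) → H¹(ℚ_∞, ·)` have
finite kernels (Greenberg's Lemma 3.1, `finite_subgroupResKer_kerSubgroup`) and the `2`-torsion of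
the Selmer groups is finite. [cite: GreenbergLNM1716, §3 Lemma 3.1] -/
theorem finite_ker_compMap (hex : ∃ σ : Field.absoluteGaloisGroup ℚ, σ • δ = -δ)
    (hγ : κ.IsTopGenerator γ) : Finite (T.compMap hC hδ hneg p hκ).ker := by
  have hp := (Fact.out : p.Prime)
  obtain ⟨σm, hσm⟩ := hex
  -- the finite pieces
  haveI hF : Finite (subgroupResKer (geomPrimaryTorsion (W⁄ℚ) p) κ.kerSubgroup) :=
    (W⁄ℚ).finite_subgroupResKer_kerSubgroup κ hγ (p := p)
  haveI hF' : Finite (subgroupResKer (geomPrimaryTorsion (W'⁄ℚ) p) κ.kerSubgroup) :=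
    (W'⁄ℚ).finite_subgroupResKer_kerSubgroup κ hγ (p := p)
  haveI := finite_torsionBy_selmerGroupPInfty (W⁄ℚ) p
  haveI := finite_torsionBy_selmerGroupPInfty (W'⁄ℚ) p
  haveI h2 : Finite (selmerGroupPInfty (W⁄ℚ) p)[((2 : ℕ) : ℤ)] :=
    finite_torsionBy_of_primary _ hp (primary_selmerGroupPInfty p (W⁄ℚ)) two_ne_zero
  haveI h2' : Finite (selmerGroupPInfty (W'⁄ℚ) p)[((2 : ℕ) : ℤ)] :=
    finite_torsionBy_of_primary _ hp (primary_selmerGroupPInfty p (W'⁄ℚ)) two_ne_zero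
  -- the two consequences of `Θ (η, η') = 0`
  have key : ∀ x ∈ (T.compMap hC hδ hneg p hκ).ker,
      (W⁄ℚ).resInfty p κ ((2 • x.1 : selmerGroupPInfty (W⁄ℚ) p) : galH1Primary (W⁄ℚ) p) = 0 ∧
      (W'⁄ℚ).resInfty p κ ((2 • x.2 : selmerGroupPInfty (W'⁄ℚ) p) : galH1Primary (W'⁄ℚ) p) = 0 := by
    intro x hx
    have h0 := congrArg (fun z : (W⁄ℚ).selmerInfty κ ↦ (z : (W⁄ℚ).subgroupH1 p κ.kerSubgroup))
      ((AddMonoidHom.mem_ker).mp hx)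
    simp only [coe_compMap, ZeroMemClass.coe_zero] at h0
    have h1 := congrArg ((W⁄ℚ).conjH1 p κ.kerSubgroup σm) h0
    rw [map_add, map_zero, conjH1_resInfty, T.conjH1_h1_of_smul_eq_neg hC hneg p hκ hσm,
      conjH1_resInfty] at h1
    set A := (W⁄ℚ).resInfty p κ (x.1 : galH1Primary (W⁄ℚ) p) with hAdef
    set B := T.h1 hC p κ.kerSubgroup hκ ((W'⁄ℚ).resInfty p κ (x.2 : galH1Primary (W'⁄ℚ) p))
      with hBdef
    have hsum : 2 • A = 0 := by
      have e : 2 • A = (A + B) + (A + -B) := by rw [two_nsmul]; abel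
      rw [e, h0, h1, add_zero]
    have hdiff : 2 • B = 0 := by
      have e : 2 • B = (A + B) - (A + -B) := by rw [two_nsmul]; abel
      rw [e, h0, h1, sub_zero]
    refine ⟨?_, ?_⟩
    · rw [AddSubgroupClass.coe_nsmul, map_nsmul]; exact hsum
    · rw [← map_nsmul, map_eq_zero_iff _ (T.h1 hC p κ.kerSubgroup hκ).injective] at hdiff
      rw [AddSubgroupClass.coe_nsmul, map_nsmul]; exact hdiff
  -- `x ↦ (2 η, 2 η')` maps `ker Θ` into the finite kernels, with kernel inside the `2`-torsion
  let f : (T.compMap hC hδ hneg p hκ).ker →+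
      subgroupResKer (geomPrimaryTorsion (W⁄ℚ) p) κ.kerSubgroup ×
        subgroupResKer (geomPrimaryTorsion (W'⁄ℚ) p) κ.kerSubgroup :=
    AddMonoidHom.mk'
      (fun x ↦ (⟨((2 • x.1.1 : selmerGroupPInfty (W⁄ℚ) p) : galH1Primary (W⁄ℚ) p),
          (mem_subgroupResKer_iff _ _ _).mpr (key x.1 x.2).1⟩,
        ⟨((2 • x.1.2 : selmerGroupPInfty (W'⁄ℚ) p) : galH1Primary (W'⁄ℚ) p),
          (mem_subgroupResKer_iff _ _ _).mpr (key x.1 x.2).2⟩))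
      fun x y ↦ Prod.ext (Subtype.ext (by simp [smul_add])) (Subtype.ext (by simp [smul_add]))
  haveI : Finite f.ker := by
    refine Finite.of_injective (fun x : f.ker ↦
      ((⟨x.1.1.1, ?_⟩ : (selmerGroupPInfty (W⁄ℚ) p)[((2 : ℕ) : ℤ)]),
        (⟨x.1.1.2, ?_⟩ : (selmerGroupPInfty (W'⁄ℚ) p)[((2 : ℕ) : ℤ)]))) ?_
    · have hx := congrArg (fun z ↦ ((z.1 : subgroupResKer _ _) : galH1Primary (W⁄ℚ) p))
        ((AddMonoidHom.mem_ker).mp x.2)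
      simp only [f, AddMonoidHom.mk'_apply, Prod.fst_zero, ZeroMemClass.coe_zero,
        ZeroMemClass.coe_eq_zero] at hx
      exact AddSubgroup.torsionBy.nsmul_iff.mpr hx
    · have hx := congrArg (fun z ↦ ((z.2 : subgroupResKer _ _) : galH1Primary (W'⁄ℚ) p))
        ((AddMonoidHom.mem_ker).mp x.2)
      simp only [f, AddMonoidHom.mk'_apply, Prod.snd_zero, ZeroMemClass.coe_zero,
        ZeroMemClass.coe_eq_zero] at hx
      exact AddSubgroup.torsionBy.nsmul_iff.mpr hx
    · intro a b h
      simp only [Prod.mk.injEq, Subtype.mk.injEq] at h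
      exact Subtype.ext (Subtype.ext (Prod.ext h.1 h.2))
  exact finite_of_finite_ker_of_finite f

include hC hδ hneg hκ in
/-- **`corank Sel_{p^∞}(E/ℚ) + corank Sel_{p^∞}(E'/ℚ) ≤ λ(X(E/ℚ_∞))`** for a `ℚ̄`-isomorphism
`E' ≅ E` twisted by a quadratic character whose field `ℚ(δ)` lies in `ℚ_∞ = ℚ̄^{ker κ}`, any
`ℤ_p`-extension datum `(κ, γ)` and any Pontryagin-dual datum `D` of `Sel_{p^∞}(E/ℚ_∞)` with
`X = D.X` finitely generated and torsion: `Θ` has finite kernel (`finite_ker_compMap`), so the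
Pontryagin rank bound (`SelmerDualData.zpCorank_le_lambdaInvariant_of_finite_ker`) and additivity
of the corank (`zpCorank_prod`) give the inequality. Greenberg's Thm. 1.9 at the layer `ℚ(δ)`
combined with `X_p(E/ℚ(δ)) = X_p(E/ℚ) ⊕ X_p(E'/ℚ)` (Dokchitser–Dokchitser Lemma 4.14), proved
directly inside `ℚ̄`. [cite: GreenbergLNM1716, Thm. 1.9 (§1, PDF p. 63) with §3 Lemma 3.1]
[cite: DokchitserDokchitserAnnals2010, Lemma 4.14] -/
theorem selmerCorank_add_le_lambdaInvariant (hex : ∃ σ : Field.absoluteGaloisGroup ℚ, σ • δ = -δ)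
    (hγ : κ.IsTopGenerator γ) (D : (W⁄ℚ).SelmerDualData κ γ)
    [Module.Finite (IwasawaAlgebra p) D.X] (hD : D.IsTorsion) :
    (W⁄ℚ).selmerCorank p + (W'⁄ℚ).selmerCorank p ≤ lambdaInvariant p D.X := by
  have hp := (Fact.out : p.Prime)
  haveI := T.finite_ker_compMap hC hδ hneg p hκ hex hγ
  haveI := finite_torsionBy_selmerGroupPInfty (W⁄ℚ) p
  haveI := finite_torsionBy_selmerGroupPInfty (W'⁄ℚ) p
  have hA := primary_selmerGroupPInfty p (W⁄ℚ)
  have hA' := primary_selmerGroupPInfty p (W'⁄ℚ)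
  have hAA : ∀ x : selmerGroupPInfty (W⁄ℚ) p × selmerGroupPInfty (W'⁄ℚ) p,
      ∃ n : ℕ, p ^ n • x = 0 := by
    intro x
    obtain ⟨n, hn⟩ := hA x.1
    obtain ⟨n', hn'⟩ := hA' x.2
    refine ⟨n + n', Prod.ext ?_ ?_⟩
    · rw [Prod.smul_fst, pow_add, mul_nsmul, hn, smul_zero, Prod.fst_zero]
    · rw [Prod.smul_snd, pow_add, mul_nsmul', hn', smul_zero, Prod.snd_zero]
  haveI : Finite (selmerGroupPInfty (W⁄ℚ) p × selmerGroupPInfty (W'⁄ℚ) p)[(p : ℤ)] := by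
    refine Finite.of_injective (fun x ↦
      ((⟨x.1.1, AddSubgroup.torsionBy.nsmul_iff.mpr ?_⟩ : (selmerGroupPInfty (W⁄ℚ) p)[(p : ℤ)]),
        (⟨x.1.2, AddSubgroup.torsionBy.nsmul_iff.mpr ?_⟩ :
          (selmerGroupPInfty (W'⁄ℚ) p)[(p : ℤ)]))) ?_
    · exact congrArg Prod.fst (AddSubgroup.torsionBy.nsmul_iff.mp x.2)
    · exact congrArg Prod.snd (AddSubgroup.torsionBy.nsmul_iff.mp x.2)
    · intro a b h
      simp only [Prod.mk.injEq, Subtype.mk.injEq] at h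
      exact Subtype.ext (Prod.ext h.1 h.2)
  have h := D.zpCorank_le_lambdaInvariant_of_finite_ker hD hAA (T.compMap hC hδ hneg p hκ)
  rw [zpCorank_prod hA hA'] at h
  exact h

end Literature.NumberTheory.EllipticCurves.GeomTransport

/-! ## The quadratic twist: `s_p(E/ℚ) + s_p(E^{(c)}/ℚ) ≤ λ(X(E/ℚ_∞))` when `√c ∈ ℚ_∞` -/

namespace WeierstrassCurve

/-- A square root `δ ∉ ℚ` of a rational number is moved by some `σ ∈ Γ_ℚ` (to `-δ`): the fixed
field of `Γ_ℚ` acting on `ℚ̄` is `ℚ` (Mathlib `InfiniteGalois.mem_range_algebraMap_iff_fixed`).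
[folklore] -/
private theorem exists_smul_eq_neg_of_not_mem_range {c : ℚ} {δ : AlgebraicClosure ℚ}
    (hδ : δ ∉ Set.range (algebraMap ℚ (AlgebraicClosure ℚ)))
    (hδ2 : δ ^ 2 = algebraMap ℚ (AlgebraicClosure ℚ) c) :
    ∃ σ : Field.absoluteGaloisGroup ℚ, σ • δ = -δ := by
  by_contra h
  push Not at h
  have hfix : ∀ σ : Field.absoluteGaloisGroup ℚ, σ • δ = δ := fun σ ↦
    (smul_eq_or_smul_eq_neg_of_sq_eq hδ2 σ).resolve_right (h σ)
  apply hδ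
  haveI : IsGalois ℚ (AlgebraicClosure ℚ) :=
    @IsAlgClosure.isGalois ℚ (AlgebraicClosure ℚ) _ _ (AlgebraicClosure.instAlgebra ℚ) _ _
  exact (InfiniteGalois.mem_range_algebraMap_iff_fixed δ).mpr fun f ↦ hfix f

/-- **`corank_{ℤ_p} Sel_{p^∞}(E/ℚ) + corank_{ℤ_p} Sel_{p^∞}(E^{(c)}/ℚ) ≤ λ(X(E/ℚ_∞))` whenever
`√c ∈ ℚ_∞`.** For an elliptic curve `E/ℚ` (`W`), `c ∈ ℚˣ` with a square root `δ ∈ ℚ̄ ∖ ℚ` fixed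
by `Gal(ℚ̄/ℚ_∞) = ker κ` of a `ℤ_p`-extension `ℚ_∞/ℚ` (`κ`, topological generator `γ`), and a
Pontryagin-dual datum `D` of `Sel_{p^∞}(E/ℚ_∞)` with `X = D.X` finitely generated and torsion over
`Λ`: `s_p(E/ℚ) + s_p(E^{(c)}/ℚ) ≤ λ(X) = dim_{ℚ_p}(ℚ_p ⊗ X)`. This is Greenberg's Theorem 1.9
(Selmer-corank clause) at the quadratic layer `ℚ(√c) ⊆ ℚ_∞` combined with
`X_p(E/ℚ(√c)) = X_p(E/ℚ) ⊕ X_p(E^{(c)}/ℚ)` (Dokchitser–Dokchitser 2010, Lemma 4.14; T. Dokchitser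
2013, §4), PROVED here directly inside one algebraic closure: the twisting transport
`E^{(c)}_{ℚ̄} ≅ E_{ℚ̄}` (`GeomTransport.ofQuadraticTwist`, Silverman X.5.4) is `ker κ`-equivariant,
so `(η, η') ↦ res η + ψ_* res η'` maps `Sel(E/ℚ) × Sel(E^{(c)}/ℚ)` to `Sel(E/ℚ_∞)` with finite kernel
(Greenberg's Lemma 3.1 and the involution `√c ↦ -√c`), and the Pontryagin dual count bounds the
corank of the source by `λ(X)`. No reduction hypothesis at `p`, no cyclotomicity.
[cite: GreenbergLNM1716, Thm. 1.9 (§1, PDF p. 63) with §3 Lemma 3.1]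
[cite: DokchitserDokchitserAnnals2010, Lemma 4.14] [cite: SilvermanAEC2009, X.5 Cor. 5.4] -/
theorem selmerCorank_add_selmerCorank_quadraticTwist_le_lambdaInvariant
    (W : WeierstrassCurve ℚ) [W.IsElliptic] {p : ℕ} [Fact p.Prime] {c : ℚ} (hc : c ≠ 0)
    {δ : AlgebraicClosure ℚ} (hδ : δ ∉ Set.range (algebraMap ℚ (AlgebraicClosure ℚ)))
    (hδ2 : δ ^ 2 = algebraMap ℚ (AlgebraicClosure ℚ) c)
    {κ : ZpExtension ℚ p} {γ : Field.absoluteGaloisGroup ℚ} (hγ : κ.IsTopGenerator γ)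
    (hκ : ∀ σ ∈ κ.kerSubgroup, σ • δ = δ)
    (D : W.SelmerDualData κ γ) [Module.Finite (IwasawaAlgebra p) D.X] (hD : D.IsTorsion) :
    W.selmerCorank p + (W.quadraticTwist c).selmerCorank p ≤ lambdaInvariant p D.X := by
  haveI hW' : (W.quadraticTwist c).IsElliptic := W.isElliptic_quadraticTwist hc
  haveI : (W⁄ℚ).IsElliptic := ‹W.IsElliptic›
  haveI : ((W.quadraticTwist c)⁄ℚ).IsElliptic := hW'
  have hC : ∀ g : AlgebraicClosure ℚ →+* AlgebraicClosure ℚ, g δ = δ →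
      (GeomTransport.ofQuadraticTwist W (W.quadraticTwist c) (sqChange_spec W) (one_smul _ _)
        hδ hδ2).C.map g =
      (GeomTransport.ofQuadraticTwist W (W.quadraticTwist c) (sqChange_spec W) (one_smul _ _)
        hδ hδ2).C :=
    fun g hg ↦ GeomTransport.ofQuadraticTwist_C_map_eq W (W.quadraticTwist c) (sqChange_spec W)
      (one_smul _ _) hδ hδ2 hg
  have hneg : ∀ σ : Field.absoluteGaloisGroup ℚ, σ • δ = -δ →
      ∀ x : geomPoints ((W.quadraticTwist c)⁄ℚ),
        (GeomTransport.ofQuadraticTwist W (W.quadraticTwist c) (sqChange_spec W) (one_smul _ _)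
          hδ hδ2).equiv (σ • x) =
        -(σ • (GeomTransport.ofQuadraticTwist W (W.quadraticTwist c) (sqChange_spec W)
          (one_smul _ _) hδ hδ2).equiv x) := by
    intro σ hσ x
    rw [eq_neg_iff_add_eq_zero, ← neg_eq_iff_add_eq_zero]
    exact (GeomTransport.smul_equiv_ofQuadraticTwist_of_smul_eq_neg W (W.quadraticTwist c)
      (sqChange_spec W) (one_smul _ _) hδ hδ2 hσ x).symm
  exact (GeomTransport.ofQuadraticTwist W (W.quadraticTwist c) (sqChange_spec W) (one_smul _ _)
    hδ hδ2).selmerCorank_add_le_lambdaInvariant hC (smul_eq_or_smul_eq_neg_of_sq_eq hδ2) hneg p hκ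
    (exists_smul_eq_neg_of_not_mem_range hδ hδ2) hγ D hD

end WeierstrassCurve

/-! ## `p = 2`, `c = 2`: `ℚ(√2) = ℚ_1 ⊆ ℚ_∞^{cyc}` — conjunct (d) of the `TwoAdicLambdaTransport`
## fact pack as a THEOREM -/

namespace Literature.NumberTheory.EllipticCurves.Greenberg1999

/-- `2` is not the square of a rational number. [folklore] -/
private theorem not_exists_rat_sq_eq_two' : ¬ ∃ q : ℚ, q ^ 2 = 2 := by
  rintro ⟨q, hq⟩
  have hq' : ((|q| : ℚ) : ℝ) = Real.sqrt 2 := by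
    rw [Rat.cast_abs, ← Real.sqrt_sq_eq_abs, ← Rat.cast_pow, hq, Rat.cast_ofNat]
  exact irrational_sqrt_two ⟨|q|, hq'⟩

/-- **`s₂(E/ℚ) + s₂(E^{(2)}/ℚ) ≤ λ(X₂(E/ℚ_∞)) = D.lambda`** for every elliptic curve `E/ℚ`, every
CYCLOTOMIC `ℤ_2`-extension datum `(κ, γ)` of `ℚ` and every Pontryagin-dual datum `D` of
`Sel_{2^∞}(E/ℚ_∞)` with `X` torsion over `Λ` (finitely generated automatically,
`SelmerDualData.module_finite_of_isCyclotomic`): the first layer `ℚ_1` of `κ` contains `√2`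
(`ZpExtension.IsCyclotomic.exists_sq_eq_two_layer_one`), which is therefore fixed by
`ker κ ≤ κ⁻¹(2ℤ_2) = Gal(ℚ̄/ℚ_1)`, and `selmerCorank_add_selmerCorank_quadraticTwist_le_lambdaInvariant`
applies with `c = 2`. This is the statement that the sibling file `SelmerCorankLayerBoundAtTwoProofs`
derives from the NAMED FACT `thm19_selmerCorank_layer_le_lambdaInvariant` (Greenberg's Thm. 1.9,
corank clause, at the layer `ℚ_1`); here it is a theorem.
[cite: GreenbergLNM1716, Thm. 1.9 (§1, PDF p. 63)] [cite: DokchitserDokchitserAnnals2010, Lemma 4.14]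
[cite: Washington1997, §13.1] -/
theorem selmerCorank_add_selmerCorank_quadraticTwist_two_le_lambda_of_isCyclotomic
    (W : WeierstrassCurve ℚ) [W.IsElliptic] {κ : ZpExtension ℚ 2} {γ : Field.absoluteGaloisGroup ℚ}
    (hκ : κ.IsCyclotomic) (hγ : κ.IsTopGenerator γ) (D : W.SelmerDualData κ γ) (hD : D.IsTorsion) :
    W.selmerCorank 2 + (W.quadraticTwist 2).selmerCorank 2 ≤ D.lambda := by
  haveI : Module.Finite (IwasawaAlgebra 2) D.X :=
    SelmerDualData.module_finite_of_isCyclotomic (W := W) κ hκ D hγ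
  obtain ⟨θ, hθ⟩ := hκ.exists_sq_eq_two_layer_one
  have hδ2 : (θ : AlgebraicClosure ℚ) ^ 2 = algebraMap ℚ (AlgebraicClosure ℚ) 2 := by
    have h := congrArg (κ.layer 1).val hθ
    rw [map_pow, map_ofNat] at h
    rw [map_ofNat]
    exact h
  have hδ : (θ : AlgebraicClosure ℚ) ∉ Set.range (algebraMap ℚ (AlgebraicClosure ℚ)) := by
    rintro ⟨q, hq⟩
    apply not_exists_rat_sq_eq_two'
    refine ⟨q, ?_⟩
    have h2 : algebraMap ℚ (AlgebraicClosure ℚ) (q ^ 2) = algebraMap ℚ (AlgebraicClosure ℚ) 2 := by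
      rw [map_pow, hq, hδ2]
    exact (algebraMap ℚ (AlgebraicClosure ℚ)).injective h2
  have hκδ : ∀ σ ∈ κ.kerSubgroup, σ • (θ : AlgebraicClosure ℚ) = θ := fun σ hσ ↦
    (κ.mem_layerSubgroup_iff_forall_smul 1 σ).mp (κ.kerSubgroup_le_layerSubgroup 1 hσ) θ θ.2
  exact W.selmerCorank_add_selmerCorank_quadraticTwist_le_lambdaInvariant two_ne_zero hδ hδ2 hγ
    hκδ D hD

/-- **Conjunct (d) of the `TwoAdicLambdaTransport` fact pack `PublishedInputsAtTwo`, verbatim in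
its binders, as a THEOREM** (cell `bsd-rank2`, door (F\*); the hypothesis `h19` of
`Summit.BirchSwinnertonDyer.Rank2.Family81517.publishedInputsAtTwo_of_facts`, hitherto fed by the
named fact `thm19_selmerCorank_layer_le_lambdaInvariant` through
`…quadraticTwist_two_le_of_isOrdinaryAt`): for every globally minimal elliptic `E/ℚ` good ordinary
at `2`, every cyclotomic `ℤ_2`-extension datum `(κ, γ)` and every `Λ`-torsion dual datum `D`,
`s₂(E/ℚ) + s₂(E^{(2)}/ℚ) ≤ D.lambda`. The minimality and ordinarity binders are idle.
[cite: GreenbergLNM1716, Thm. 1.9 (§1, PDF p. 63)] [cite: DokchitserDokchitserAnnals2010, Lemma 4.14] -/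
theorem selmerCorank_add_selmerCorank_quadraticTwist_two_le_of_isOrdinaryAt :
    ∀ (W : WeierstrassCurve ℚ) [W.IsElliptic] [W.IsGloballyMinimal], IsOrdinaryAt W 2 →
      ∀ (κ : ZpExtension ℚ 2) (γ : Field.absoluteGaloisGroup ℚ),
        κ.IsCyclotomic → κ.IsTopGenerator γ →
          ∀ D : W.SelmerDualData κ γ, D.IsTorsion →
            W.selmerCorank 2 + (W.quadraticTwist 2).selmerCorank 2 ≤ D.lambda :=
  fun W _ _ _ _ _ hκ hγ D hD ↦
    selmerCorank_add_selmerCorank_quadraticTwist_two_le_lambda_of_isCyclotomic W hκ hγ D hD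

end Literature.NumberTheory.EllipticCurves.Greenberg1999

end
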